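import Literature.AlgebraicGeometry.Motives.ComplexPointsSubmersion
import Literature.NumberTheory.Transcendental.AnalytificationProofs
import HarnessLib

/-!
# Regular functions are `C^∞` on the real manifold `X(ℂ)` of complex points

For a scheme `X` smooth of relative dimension `n` and locally of finite type over `ℂ`, the tree's
`ComplexPoints.chartedSpace X n` (`Motives/ComplexPointsManifold`, `Motives/ComplexPointsSubmersion`) is the
`C^∞` real `2n`-manifold structure on `X(ℂ)` whose charts are the holomorphic algebraic charts followed by
`ℂⁿ ≃ ℝ²ⁿ`. Serre (GAGA §2 n°5 Prop. 2, n°6: «toute fonction régulière est holomorphe») — in the tree the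
second half of `ComplexPoints.algebraicChart_spec` — says that a regular function `s ∈ Γ(X, U)` on an affine
open `U`, read in any algebraic chart, is holomorphic on the chart image of `U(ℂ)`. This file turns that into
the statements consumed by differential-topological constructions on `X(ℂ)` (vector fields, flows, cut-offs
built from regular coordinates):

* `contDiffAt_evalOrZero_comp_symm` — `s ∘ (algebraicChart P)⁻¹` is `ℂ`-analytic at the chart image of a
  point `P ∈ U(ℂ)`;
* `contMDiffAt_evalOrZero` — the total evaluation `P ↦ s(P)` (`AlgPoints.evalOrZero`, extended by `0` off
  `U(ℂ)`) is `C^∞` at every point of `U(ℂ)` as a map of real manifolds `X(ℂ) → ℂ`, for `U` affine;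
* `contMDiffAt_evalOrZero_opens`, `contMDiffOn_evalOrZero_opens` — the same for an arbitrary open `U`
  (restrict to an affine open neighbourhood, `AlgPoints.evalOrZero_map_homOfLE`);
* `contMDiff_evalOrZero_top` — global regular functions are `C^∞` on all of `X(ℂ)`.

All statements carry the manifold structure as `letI := ComplexPoints.chartedSpace X n` (no instance attribute),
so that consumers opening it as a local instance see the same terms. Everything is proved; no definitions, no
named facts.

## References

* [SerreGAGA1956] J.-P. Serre, Géométrie algébrique et géométrie analytique, Ann. Inst. Fourier 6 (1956),
  §2 n°5 Prop. 2, n°6 p. 12 («toute fonction régulière est holomorphe»).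
* [Hartshorne1977] R. Hartshorne, Algebraic Geometry (1977), App. B §1 (the associated complex analytic space).
-/

noncomputable section

open CategoryTheory AlgebraicGeometry Filter Topology
open scoped ContDiff Manifold
open Literature.AlgebraicGeometry.Motives.AlgPoints (evalOrZero)
open Literature.NumberTheory.Transcendental

namespace Literature.AlgebraicGeometry.Motives.ComplexPoints

variable (X : SchemeOver ℂ) (n : ℕ) [LocallyOfFiniteType X.hom] [SmoothOfRelativeDimension n X.hom]

/-- **A regular function read in an algebraic chart is holomorphic** at the chart image of every point of
`U(ℂ)` (`U` affine): the pointwise form of the second half of `algebraicChart_spec`.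
[cite: SerreGAGA1956, §2 n°5 Prop. 2] -/
theorem contDiffAt_evalOrZero_comp_symm (U : X.left.affineOpens) (s : Γ(X.left, ↑U))
    {P : ComplexPoints X} (hP : P.pt ∈ (↑U : X.left.Opens)) :
    ContDiffAt ℂ ω (evalOrZero ↑U s ∘ (algebraicChart X n P).symm) (algebraicChart X n P P) := by
  obtain ⟨-, hol⟩ := algebraicChart_spec X n P
  have hopen : IsOpen ((algebraicChart X n P).target ∩
      (algebraicChart X n P).symm ⁻¹' {Q | Q.pt ∈ (↑U : X.left.Opens)}) :=
    (algebraicChart X n P).isOpen_inter_preimage_symm (AlgPoints.isOpen_setOf_pt_mem _)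
  have hmem : algebraicChart X n P P ∈ (algebraicChart X n P).target ∩
      (algebraicChart X n P).symm ⁻¹' {Q | Q.pt ∈ (↑U : X.left.Opens)} :=
    ⟨(algebraicChart X n P).map_source (mem_algebraicChart_source X n P), by
      simp only [Set.mem_preimage, Set.mem_setOf_eq,
        (algebraicChart X n P).left_inv (mem_algebraicChart_source X n P)]
      exact hP⟩
  exact (hol U s).contDiffAt (hopen.mem_nhds hmem)

/-- **Regular functions on an affine open are `C^∞` on `U(ℂ)`** for the real manifold structure
`ComplexPoints.chartedSpace X n`: `P ↦ s(P)` is `C^∞` at every `P` with `P.pt ∈ U`.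
[cite: SerreGAGA1956, §2 n°5 Prop. 2, n°6 p. 12] -/
theorem contMDiffAt_evalOrZero (U : X.left.affineOpens) (s : Γ(X.left, ↑U))
    {P : ComplexPoints X} (hP : P.pt ∈ (↑U : X.left.Opens)) :
    letI := ComplexPoints.chartedSpace X n
    ContMDiffAt (𝓡 (2 * n)) 𝓘(ℝ, ℂ) ∞ (evalOrZero ↑U s) P := by
  letI := ComplexPoints.chartedSpace X n
  set L := ContinuousLinearEquiv.ofFinrankEq (finrank_real_pi_complex_eq n) with hL
  have key : ContDiffAt ℝ ∞ (fun z : EuclideanSpace ℝ (Fin (2 * n)) =>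
      evalOrZero ↑U s ((algebraicChart X n P).symm ((complexToEuclidean n).symm z)))
      (complexToEuclidean n (algebraicChart X n P P)) := by
    have h1 : ContDiffAt ℝ ∞ (evalOrZero ↑U s ∘ (algebraicChart X n P).symm)
        ((complexToEuclidean n).symm (complexToEuclidean n (algebraicChart X n P P))) := by
      rw [Homeomorph.symm_apply_apply]
      exact ((contDiffAt_evalOrZero_comp_symm X n U s hP).restrict_scalars ℝ).of_le le_top
    have h2 : ContDiffAt ℝ ∞ (⇑(complexToEuclidean n).symm)
        (complexToEuclidean n (algebraicChart X n P P)) := by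
      rw [coe_complexToEuclidean_symm]
      exact L.symm.contDiff.contDiffAt
    exact h1.comp _ h2
  rw [contMDiffAt_iff]
  refine ⟨(AlgPoints.continuousOn_evalOrZero _ s).continuousAt
    ((AlgPoints.isOpen_setOf_pt_mem _).mem_nhds hP), ?_⟩
  have hF : (extChartAt 𝓘(ℝ, ℂ) (evalOrZero ↑U s P)) ∘ evalOrZero ↑U s ∘ (extChartAt (𝓡 (2 * n)) P).symm =
      fun z : EuclideanSpace ℝ (Fin (2 * n)) =>
        evalOrZero ↑U s ((algebraicChart X n P).symm ((complexToEuclidean n).symm z)) := by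
    funext z
    rfl
  have hpt : extChartAt (𝓡 (2 * n)) P P = complexToEuclidean n (algebraicChart X n P P) := rfl
  have hr : Set.range (𝓡 (2 * n)) = Set.univ := by
    simp only [modelWithCornersSelf_coe, Set.range_id]
  rw [hF, hpt, hr, contDiffWithinAt_univ]
  exact key

/-- **Regular functions on any open are `C^∞` on `U(ℂ)`**: restrict `s` to an affine open neighbourhood
`V ⊆ U` of `P.pt`; on the open neighbourhood `V(ℂ)` of `P` the two evaluations agree
(`AlgPoints.evalOrZero_map_homOfLE`). [cite: SerreGAGA1956, §2 n°6 p. 12] -/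
theorem contMDiffAt_evalOrZero_opens (U : X.left.Opens) (s : Γ(X.left, U))
    {P : ComplexPoints X} (hP : P.pt ∈ U) :
    letI := ComplexPoints.chartedSpace X n
    ContMDiffAt (𝓡 (2 * n)) 𝓘(ℝ, ℂ) ∞ (evalOrZero U s) P := by
  letI := ComplexPoints.chartedSpace X n
  obtain ⟨V, hVaff, hPV, hVU⟩ := exists_isAffineOpen_mem_and_subset (X := X.left) (U := U) hP
  have hVU' : V ≤ U := hVU
  have h := contMDiffAt_evalOrZero X n ⟨V, hVaff⟩ (X.left.presheaf.map (homOfLE hVU').op s) hPV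
  refine h.congr_of_eventuallyEq ?_
  filter_upwards [(AlgPoints.isOpen_setOf_pt_mem V).mem_nhds hPV] with Q hQ
  exact (AlgPoints.evalOrZero_map_homOfLE hVU' s hQ).symm

/-- `contMDiffAt_evalOrZero_opens` on the whole open set `U(ℂ)`. [cite: SerreGAGA1956, §2 n°6 p. 12] -/
theorem contMDiffOn_evalOrZero_opens (U : X.left.Opens) (s : Γ(X.left, U)) :
    letI := ComplexPoints.chartedSpace X n
    ContMDiffOn (𝓡 (2 * n)) 𝓘(ℝ, ℂ) ∞ (evalOrZero U s) {P : ComplexPoints X | P.pt ∈ U} := by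
  letI := ComplexPoints.chartedSpace X n
  exact fun _ hP => (contMDiffAt_evalOrZero_opens X n U s hP).contMDiffWithinAt

/-- **Global regular functions are `C^∞` on `X(ℂ)`.** [cite: SerreGAGA1956, §2 n°6 p. 12] -/
theorem contMDiff_evalOrZero_top (s : Γ(X.left, ⊤)) :
    letI := ComplexPoints.chartedSpace X n
    ContMDiff (𝓡 (2 * n)) 𝓘(ℝ, ℂ) ∞ (evalOrZero ⊤ s : ComplexPoints X → ℂ) := by
  letI := ComplexPoints.chartedSpace X n
  exact fun _ => contMDiffAt_evalOrZero_opens X n ⊤ s trivial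

/-- The differentiable (`C¹`-free) form: regular functions are `MDifferentiableAt` at points of `U(ℂ)`.
[cite: SerreGAGA1956, §2 n°6 p. 12] -/
theorem mdifferentiableAt_evalOrZero_opens (U : X.left.Opens) (s : Γ(X.left, U))
    {P : ComplexPoints X} (hP : P.pt ∈ U) :
    letI := ComplexPoints.chartedSpace X n
    MDifferentiableAt (𝓡 (2 * n)) 𝓘(ℝ, ℂ) (evalOrZero U s) P := by
  letI := ComplexPoints.chartedSpace X n
  exact (contMDiffAt_evalOrZero_opens X n U s hP).mdifferentiableAt (by simp)

end Literature.AlgebraicGeometry.Motives.ComplexPoints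

end
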